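import Summits.ResolutionOfSingularities.ResolutionOfSingularities.Theorems.MarkedTransferCampaignW25FiniteRaySB
import Summits.ResolutionOfSingularities.ResolutionOfSingularities.Theorems.MarkedTransferCampaignW25SWStdExpr
import Summits.ResolutionOfSingularities.ResolutionOfSingularities.Theorems.MarkedTransferCampaignW25FiniteABRay
import Literature.AlgebraicGeometry.Hironaka2017.Lib.FrobeniusPower
import HarnessLib

/-!
# K2.5 record, carrier SB, SECOND model of `M_<` (p502315 `CampaignW25.MemBelowSpan`): the BOX cell is YES
# — slot W2.5 = L-47B-s3 «FINITE AB-RAY SUFFICES» (DEAD 06:16:15Z on SW, registered model; NOT touched here)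

[OURS · L W2.5 · K2.5 record · typer-of-record after-care, counted 0] HIRONAKA CAMPAIGN D-0089, rescue ladder L, group G2
(§9 `H♭`), GAP row R47 (B) (Lemma 9.5 p.50 l.11–14, COUPLED depth choice). res-adj-2's K25 VERDICT line (HOME/STATUS.md
2026-08-27T06:16:15Z) ACCEPTS p502315's `CampaignW25.IsBelowRay` / `MemBelowSpan` as «an admissible second reading» of
«the `ρ^ℓ(O)`-submodule generated by the monomials strictly BELOW the AB-ray» (PREREG k25 (iii)) and states in its item
(β), for the carrier SB = `Σ_{k≥1} ω₁^{2k}ω₂³` (res-type-055 `Lem95CoupledBox`, p491132) under the K24 «Frobenius box»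
reading of «derivative orders `< p^ℓ`»: «NO under BOTH readings». The registered model (k25, p502943: `SW.MemBelow` =
every monomial of the difference has digit pair `<lex (α, β)`) is certified NO in `MarkedTransferCampaignW25FiniteRaySB.lean`
(p505387, `SB.not_existsAdmissibleFiniteRay_box`). THIS FILE certifies the other cell, as announced on STATUS
2026-08-27T06:20:48Z: under the SECOND model — `M_<` = finite `ρ^ℓ(𝔽₂⟦x⟧)`-combinations of monomials `x^{a+pb+qc}`
whose triple is below the ray, where a triple of the SAME pair `(α, β)` with `c <lex` EVERY ray member also counts as
below (`CampaignW25.IsBelowRay`, second disjunct) — the BOX form of the question has a POSITIVE answer on SB at every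
depth `ℓ ≥ 2`.

## RESULT (`E_SB = toFin 𝔽 2 εB ∈ 𝔽₂⟦x₀, x₁, x₂⟧`, `x₀ = y`, `x₁ = ω₁`, `x₂ = ω₂`, `p = 2`, `e = 1`, every `ℓ ≥ 2`)
* `existsAdmissibleFiniteRay_box_span`: there is `ε′` with `E_SB − ε′ ∈ M_<` (span model, pair `(e₂, 0)`, ray of `E_SB`)
  admitting a standard expression `X′` of depth `ℓ` with `(α, β)(X′) = (e₂, 0)`, `|α + pβ| = 1 < 2^ℓ`, and EVERY top-block
  exponent `qγ = 2c` with EVERY COORDINATE `< 2^ℓ`. Witness: `ε′ = Σ_{k ≥ 1, 2^{ℓ−1} ∤ k} ω₁^{2k} ω₂³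
  = Σ_{1 ≤ r < 2^{ℓ−1}} x^{(0,2r,3)} · U_ℓ`, `U_ℓ = (Σ_j ω₁^j)^{2^ℓ}` (k25's `SW.coefU`, `SW.thetaSW`), removed part
  `E_SB − ε′ = ω₂³ · (U_ℓ − 1)`: the generator `ω₂³` has triple `(e₂, 0, (0,0,1))`, same pair and `(0,0,1) <lex (0,k,1)`
  for every ray member (`k ≥ 1`), and `U_ℓ − 1 ∈ ρ^ℓ`; top block `{(e₂, 0, (0,r,1)) : 1 ≤ r < 2^{ℓ−1}}`, max coordinate of
  `2c` = `2^ℓ − 2`.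
* `existsAdmissibleFiniteRay_box_admBelow`: the same with the difference in p502315's `admBelow 2 1 ℓ E_SB` (pair and ray
  of EVERY depth-`ℓ` standard expression of `E_SB`; they are `(e₂, 0)` by `SB.topPair_eq`).
* instances `ℓ = 3` (max coordinate `6 < 8`) and `ℓ = 4` (`14 < 16`).
What is NOT claimed: the TOTAL-DEGREE form (k25's `SW.AdmissibleTop`: `|qγ_j| < p^ℓ`) — for the witness the top member
`r = 2^{ℓ−1} − 1` has `|2c| = 2^ℓ`; the ray of `ε′` as a SET is still infinite, so p502315's `K25Reduction 2 1 ℓ E_SB`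
(finite `rayOf` + total degree) is not obtained; K25 = DEAD rests on SW and the registered model and is not touched; no
GAP-LEDGER word is implied (res-adj-2 words R47 (B)). The truth table of the (β) cell on SB is thus: registered model ×
(box | total) = NO | NO (p505387); span model × box = YES (this file). It asserts nothing of H. Hironaka's manuscript
[Hironaka2017] (lit key `paper:url-3343fd9e678b`), which stays «under review» (D-0012/D-0089). Typed by res-type-054
(W2.5 statement typer, after-care on its own model); AI-written, weaker than expert review.

References: H. Hironaka, ms. 2017-03-23, Eq. (76)/(77) p.49, Lem. 9.5 p.50 l.11–15, p.49 l.25–28 (UNDER ADJUDICATION,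
not cited as fact). [Hironaka2017] -/

-- `Summit.<Summit>.<Sub>.Theorems` with `Sub = Summit` (single-conjunct summit, D-0017)
set_option linter.dupNamespace false

noncomputable section

namespace Summit.ResolutionOfSingularities.ResolutionOfSingularities.Theorems.CampaignW25.SBSpan

open MvPowerSeries Finset
open Literature.AlgebraicGeometry.Hironaka2017.S09LLUED
open Literature.AlgebraicGeometry.Hironaka2017.S09LLUED.TopFrontier
open Literature.AlgebraicGeometry.Hironaka2017.S09LLUED.Lem95Coupled (toFin)
open Literature.AlgebraicGeometry.Hironaka2017.S09LLUED.Lem95CoupledBox (εB coeff_E)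
open Literature.AlgebraicGeometry.Hironaka2017.S09LLUED.Lem95CoupledCountermodel (εW)
open Literature.AlgebraicGeometry.Hironaka2017.S08UnitMonomial
  (StandardExpression frobPow one_mem_frobPow sub_mem_frobPow)
open Literature.AlgebraicGeometry.Hironaka2017.S07Permissible.Cor720Countermodel (𝔽)
open Summit.ResolutionOfSingularities.ResolutionOfSingularities.Theorems.CampaignW25
  (ray rayOf IsBelowRay MemBelowSpan admBelow)
open Summit.ResolutionOfSingularities.ResolutionOfSingularities.Theorems.CampaignW25.SW
  (coefU thetaSW thetaSW_apply isUnit_coefU coefU_mem_frobPow E_eq_sum suppSW_injective)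

/-! ## §1 `E_SB = E_SW − ω₂³`, and the removed part `ω₂³ · (U_ℓ − 1)` -/

/-- `E_SB = E_SW − ω₂³` (`SB = Σ_{k≥1}`, `SW = Σ_{k≥0}`; `ω₂³ = x^{θ₀}`, `θ₀ = (0,0,3) = thetaSW 0`). [folklore] -/
theorem E_SB_eq_E_SW_sub : toFin 𝔽 2 εB = toFin 𝔽 2 εW - monomial (thetaSW 0) (1 : 𝔽) := by
  obtain ⟨h0, h1, h2⟩ := thetaSW_apply 0
  rw [mul_zero] at h1
  have key : ∀ m : Fin 3 →₀ ℕ, m = thetaSW 0 ↔ m 0 = 0 ∧ m 1 = 0 ∧ m 2 = 3 := by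
    intro m
    constructor
    · rintro rfl
      exact ⟨h0, h1, h2⟩
    · rintro ⟨hm0, hm1, hm2⟩
      ext i
      fin_cases i
      · simpa [h0] using hm0
      · simpa [h1] using hm1
      · simpa [h2] using hm2
  ext m
  rw [map_sub, coeff_E, Lem95CoupledCountermodel.coeff_E, coeff_monomial]
  by_cases hm : m 0 = 0 ∧ 2 ∣ m 1 ∧ m 2 = 3
  · obtain ⟨hm0, hm1, hm2⟩ := hm
    by_cases hz : m 1 = 0
    · rw [if_neg (fun h => h.2.2.1 hz), if_pos ⟨hm0, hm1, hm2⟩, if_pos ((key m).2 ⟨hm0, hz, hm2⟩), sub_self]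
    · rw [if_pos ⟨hm0, hm1, hz, hm2⟩, if_pos ⟨hm0, hm1, hm2⟩, if_neg (fun h => hz ((key m).1 h).2.1), sub_zero]
  · rw [if_neg (fun h => hm ⟨h.1, h.2.1, h.2.2.2⟩), if_neg hm, if_neg, sub_zero]
    intro h
    obtain ⟨hm0, hm1, hm2⟩ := (key m).1 h
    exact hm ⟨hm0, ⟨0, by rw [hm1]⟩, hm2⟩

/-- `2^ℓ = 2 · 2^{ℓ−1}` for `ℓ ≥ 1`. [folklore] -/
private theorem two_pow_eq {ℓ : ℕ} (hℓ : 1 ≤ ℓ) : 2 ^ ℓ = 2 * 2 ^ (ℓ - 1) := by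
  rw [← pow_succ', Nat.sub_add_cancel hℓ]

/-- **The removed part.** For `ℓ ≥ 1`: `E_SB − Σ_{1 ≤ r < 2^{ℓ−1}} x^{θ_r} U_ℓ = x^{θ₀} · (U_ℓ − 1) = ω₂³ (U_ℓ − 1)`
(k25's `SW.E_eq_sum`: `E_SW = Σ_{r < 2^{ℓ−1}} x^{θ_r} U_ℓ`). [folklore] -/
theorem E_SB_sub_sum_eq {ℓ : ℕ} (hℓ : 1 ≤ ℓ) :
    toFin 𝔽 2 εB - ∑ r ∈ (range (2 ^ (ℓ - 1))).erase 0, monomial (thetaSW r) (1 : 𝔽) * coefU ℓ =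
      monomial (thetaSW 0) (1 : 𝔽) * (coefU ℓ - 1) := by
  have h0 : 0 ∈ range (2 ^ (ℓ - 1)) := mem_range.2 (pow_pos two_pos _)
  rw [E_SB_eq_E_SW_sub, E_eq_sum rfl hℓ, ← add_sum_erase _ _ h0]
  ring

/-- `U_ℓ − 1 = (Σ_{j≥1} ω₁^j)^{2^ℓ} ∈ ρ^ℓ(𝔽₂⟦x⟧)` (`ρ^ℓ` is a subring in characteristic `2`). [folklore] -/
theorem coefU_sub_one_mem_frobPow (ℓ : ℕ) : coefU ℓ - 1 ∈ frobPow (MvPowerSeries (Fin 3) 𝔽) 2 ℓ := by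
  haveI : Fact (Nat.Prime 2) := ⟨Nat.prime_two⟩
  haveI : CharP (MvPowerSeries (Fin 3) 𝔽) 2 :=
    charP_of_injective_ringHom (f := (MvPowerSeries.C : 𝔽 →+* MvPowerSeries (Fin 3) 𝔽))
      MvPowerSeries.C_injective 2
  exact sub_mem_frobPow (coefU_mem_frobPow ℓ) one_mem_frobPow

/-! ## §2 The removed part lies in `M_<` of the SPAN model (p502315 `CampaignW25.MemBelowSpan`) -/

/-- The members of the AB-ray of `E_SB` over `(e₂, 0)` are the `γ = (0, k, 1)` with `k ≥ 1`; recorded as the two facts used: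
`γ₀ = 0` and `γ₁ ≥ 1`. [folklore] -/
theorem ray_E_SB_apply {γ : Fin 3 →₀ ℕ}
    (hγ : γ ∈ ray 2 1 (Finsupp.single (2 : Fin 3) 1) 0 (toFin 𝔽 2 εB)) : γ 0 = 0 ∧ 0 < γ 1 ∧ γ 2 = 1 := by
  have n01 : (0 : Fin 3) ≠ 1 := by decide
  have n02 : (0 : Fin 3) ≠ 2 := by decide
  have n12 : (1 : Fin 3) ≠ 2 := by decide
  have h : coeff (Finsupp.single (2 : Fin 3) 1 + 2 • (0 : Fin 3 →₀ ℕ) + 2 ^ 1 • γ) (toFin 𝔽 2 εB) ≠ 0 := hγ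
  rw [coeff_E] at h
  split_ifs at h with hc
  · obtain ⟨hc0, -, hc1, hc2⟩ := hc
    simp only [Finsupp.add_apply, Finsupp.smul_apply, smul_eq_mul, Finsupp.coe_zero, Pi.zero_apply, mul_zero,
      add_zero, pow_one, Finsupp.single_eq_of_ne n02, Finsupp.single_eq_of_ne n12, Finsupp.single_eq_same,
      zero_add] at hc0 hc1 hc2
    refine ⟨by omega, by omega, by omega⟩
  · exact absurd rfl h

/-- **`ω₂³ · (U_ℓ − 1) ∈ M_<` (span model)** over the pair `(e₂, 0)` and the ray of `E_SB`, every `ℓ`: one generator, the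
triple `(e₂, 0, (0,0,1))` — same pair, and `(0,0,1) <lex γ` for EVERY ray member `γ = (0, k, 1)`, `k ≥ 1` (second disjunct
of `CampaignW25.IsBelowRay`) — with coefficient `U_ℓ − 1 ∈ ρ^ℓ`. [folklore] -/
theorem memBelowSpan_removed (ℓ : ℕ) :
    MemBelowSpan 2 1 ℓ (Finsupp.single (2 : Fin 3) 1) 0 (ray 2 1 (Finsupp.single (2 : Fin 3) 1) 0 (toFin 𝔽 2 εB))
      (monomial (thetaSW 0) (1 : 𝔽) * (coefU ℓ - 1)) := by
  classical
  refine ⟨{((Finsupp.single 2 1, 0, Finsupp.single 2 1) : ExpTriple 3)}, fun _ => coefU ℓ - 1, ?_, ?_⟩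
  · intro t ht
    rw [mem_singleton] at ht
    subst ht
    refine ⟨?_, ?_, ?_, coefU_sub_one_mem_frobPow ℓ⟩
    · intro i
      fin_cases i <;> simp
    · intro i
      simp
    · right
      refine ⟨rfl, rfl, ?_⟩
      intro γ hγ
      obtain ⟨hγ0, hγ1, -⟩ := ray_E_SB_apply hγ
      refine Finsupp.Lex.lt_iff.2 ⟨1, fun j hj => ?_, ?_⟩
      · have hj0 : j = 0 := by
          fin_cases j
          · rfl
          · simp at hj
          · exact absurd hj (by decide)
        subst hj0
        simpa using hγ0.symm
      · simpa using hγ1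
  · rw [sum_singleton, mono_X_eq_monomial, mul_comm]
    show (coefU ℓ - 1) * monomial (thetaSW 0) (1 : 𝔽) =
      (coefU ℓ - 1) * monomial (Finsupp.single 2 1 + 2 • (0 : Fin 3 →₀ ℕ) + 2 ^ 1 • Finsupp.single 2 1) 1
    rw [show thetaSW 0 = Finsupp.single 2 1 + 2 • (0 : Fin 3 →₀ ℕ) + 2 ^ 1 • Finsupp.single 2 1 by
      simp [thetaSW]]

/-- The removed part lies in p502315's class `admBelow 2 1 ℓ E_SB` as well (`ℓ ≥ 2`): the pair and the ray of EVERY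
depth-`ℓ` standard expression of `E_SB` are `(e₂, 0)` and the ray above (`SB.topPair_eq`, p505387, applied to
`ε′ = E_SB`). [folklore] -/
theorem mem_admBelow_of_memBelowSpan {ℓ : ℕ} (hℓ : 2 ≤ ℓ) {h : MvPowerSeries (Fin 3) 𝔽}
    (hh : MemBelowSpan 2 1 ℓ (Finsupp.single (2 : Fin 3) 1) 0
      (ray 2 1 (Finsupp.single (2 : Fin 3) 1) 0 (toFin 𝔽 2 εB)) h) :
    h ∈ admBelow 2 1 ℓ (toFin 𝔽 2 εB) := by
  simp only [admBelow, Set.mem_setOf_eq]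
  intro X
  have hB0 : SW.MemBelow 2 1 (Finsupp.single (2 : Fin 3) 1) 0 (toFin 𝔽 2 εB - toFin 𝔽 2 εB) := by
    intro m hm
    rw [sub_self, map_zero] at hm
    exact absurd rfl hm
  obtain ⟨ha, hb⟩ := SB.topPair_eq hB0 X hℓ
  show MemBelowSpan 2 1 ℓ (alpha X.support X.u) (beta X.support X.u)
    (ray 2 1 (alpha X.support X.u) (beta X.support X.u) (toFin 𝔽 2 εB)) h
  rw [ha, hb]
  exact hh

/-! ## §3 The standard expression of `ε′ = Σ_{1 ≤ r < 2^{ℓ−1}} x^{θ_r} U_ℓ` and its top block -/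

/-- `(α, β) = (e₂, 0)` for the data `T = {(e₂, 0, (0,r,1)) : 1 ≤ r < 2^{ℓ−1}}`, `u ≡ U_ℓ` (`ℓ ≥ 2`, so that `r = 1`
occurs): all terms have the same pair. [folklore] -/
private theorem topPair_eq_data {ℓ : ℕ} (hℓ : 2 ≤ ℓ) :
    alpha (((range (2 ^ (ℓ - 1))).erase 0).image fun r : ℕ =>
        ((Finsupp.single 2 1, (0 : Fin 3 →₀ ℕ), r • Finsupp.single 1 1 + Finsupp.single 2 1) : ExpTriple 3))
        (fun _ => coefU ℓ) = Finsupp.single 2 1 ∧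
      beta (((range (2 ^ (ℓ - 1))).erase 0).image fun r : ℕ =>
        ((Finsupp.single 2 1, (0 : Fin 3 →₀ ℕ), r • Finsupp.single 1 1 + Finsupp.single 2 1) : ExpTriple 3))
        (fun _ => coefU ℓ) = 0 := by
  classical
  set T := ((range (2 ^ (ℓ - 1))).erase 0).image fun r : ℕ =>
    ((Finsupp.single 2 1, (0 : Fin 3 →₀ ℕ), r • Finsupp.single 1 1 + Finsupp.single 2 1) : ExpTriple 3) with hT
  have hP : 2 ≤ 2 ^ (ℓ - 1) := by
    calc 2 = 2 ^ 1 := by norm_num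
      _ ≤ 2 ^ (ℓ - 1) := Nat.pow_le_pow_right (by norm_num) (by omega)
  have heff : effSupport T (fun _ => coefU ℓ) = T := effSupport_eq_self _ _ fun _ _ => (isUnit_coefU ℓ).ne_zero
  have h1 : ((Finsupp.single 2 1, (0 : Fin 3 →₀ ℕ), (1 : ℕ) • Finsupp.single 1 1 + Finsupp.single 2 1) : ExpTriple 3)
      ∈ effSupport T (fun _ => coefU ℓ) := by
    rw [heff, hT]
    exact mem_image.2 ⟨1, mem_erase.2 ⟨one_ne_zero, mem_range.2 (by omega)⟩, rfl⟩
  have hmax : ∀ s ∈ effSupport T (fun _ => coefU ℓ), pairKey s ≤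
      pairKey ((Finsupp.single 2 1, (0 : Fin 3 →₀ ℕ), (1 : ℕ) • Finsupp.single 1 1 + Finsupp.single 2 1) :
        ExpTriple 3) := by
    intro s hs
    rw [heff, hT] at hs
    obtain ⟨r, -, rfl⟩ := mem_image.1 hs
    exact le_of_eq (pairKey_eq_of_eq rfl rfl)
  exact ⟨alpha_eq_of_isGreatest _ _ h1 hmax, beta_eq_of_isGreatest _ _ h1 hmax⟩

/-- **K2.5 on SB, BOX reading, SPAN model, every depth `ℓ ≥ 2`: YES.** There is `ε′` with `E_SB − ε′ ∈ M_<` (p502315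
`MemBelowSpan` over the pair `(e₂, 0)` and the AB-ray of `E_SB`) admitting a standard expression of depth `ℓ` with top pair
`(e₂, 0)`, `|α + pβ| < 2^ℓ`, and ALL top-block exponents `qγ = 2c` with EVERY COORDINATE `< 2^ℓ` — the statement shape
negated for the registered model by `SB.not_existsAdmissibleFiniteRay_box` (p505387), with the pair and `|α+pβ|` clauses
added. Witness `ε′ = Σ_{1 ≤ r < 2^{ℓ−1}} x^{(0,2r,3)} U_ℓ`, top block `{(e₂,0,(0,r,1))}`, max coordinate `2^ℓ − 2`.
[cite: Hironaka2017, Lem. 9.5 p.50 l.11–14; p.49 l.25–28 (kernel certificate about OUR model; not a verdict)] -/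
theorem existsAdmissibleFiniteRay_box_span {ℓ : ℕ} (hℓ : 2 ≤ ℓ) :
    ∃ ε' : MvPowerSeries (Fin 3) 𝔽,
      MemBelowSpan 2 1 ℓ (Finsupp.single (2 : Fin 3) 1) 0
          (ray 2 1 (Finsupp.single (2 : Fin 3) 1) 0 (toFin 𝔽 2 εB)) (toFin 𝔽 2 εB - ε') ∧
        ∃ X : StandardExpression 2 MvPowerSeries.X 1 ℓ ε',
          (alpha X.support X.u = Finsupp.single 2 1 ∧ beta X.support X.u = 0) ∧
            (topFrontierExp 2 X.support X.u).degree < 2 ^ ℓ ∧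
              ∀ t ∈ topBlock X.support X.u, ∀ i : Fin 3, (2 • t.2.2) i < 2 ^ ℓ := by
  classical
  have hℓ1 : 1 ≤ ℓ := by omega
  have hpow : 2 ^ ℓ = 2 * 2 ^ (ℓ - 1) := two_pow_eq hℓ1
  have h4 : 4 ≤ 2 ^ ℓ := by
    calc 4 = 2 ^ 2 := by norm_num
      _ ≤ 2 ^ ℓ := Nat.pow_le_pow_right (by norm_num) hℓ
  refine ⟨∑ r ∈ (range (2 ^ (ℓ - 1))).erase 0, monomial (thetaSW r) (1 : 𝔽) * coefU ℓ, ?_, ?_⟩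
  · rw [E_SB_sub_sum_eq hℓ1]
    exact memBelowSpan_removed ℓ
  · refine ⟨{ support := ((range (2 ^ (ℓ - 1))).erase 0).image fun r : ℕ =>
                ((Finsupp.single 2 1, (0 : Fin 3 →₀ ℕ), r • Finsupp.single 1 1 + Finsupp.single 2 1) : ExpTriple 3)
              u := fun _ => coefU ℓ
              u_mem := fun _ _ => coefU_mem_frobPow ℓ
              u_unit_or_zero := fun _ _ => Or.inl (isUnit_coefU ℓ)
              a_lt := ?_
              b_lt := ?_
              sum_eq := ?_ }, topPair_eq_data hℓ, ?_, ?_⟩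
    · intro t ht i
      obtain ⟨r, -, rfl⟩ := mem_image.1 ht
      fin_cases i <;> simp
    · intro t ht j
      obtain ⟨r, -, rfl⟩ := mem_image.1 ht
      simp
    · rw [sum_image fun r _ r' _ h => suppSW_injective h]
      exact sum_congr rfl fun r _ =>
        (summand_eq_monomial_mul 2 1
          ((Finsupp.single 2 1, (0 : Fin 3 →₀ ℕ), r • Finsupp.single 1 1 + Finsupp.single 2 1) : ExpTriple 3)
          (coefU ℓ)).symm
    · -- `|α + pβ| = |e₂| = 1 < 2^ℓ`
      show (alpha _ _ + 2 • beta _ _).degree < 2 ^ ℓ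
      rw [(topPair_eq_data hℓ).1, (topPair_eq_data hℓ).2, smul_zero, add_zero, Finsupp.degree_single]
      omega
    · -- the box: top block ⊆ support = {(e₂, 0, (0,r,1)) : 1 ≤ r < 2^{ℓ−1}}, `2c = (0, 2r, 2)`
      intro t ht i
      have htT := effSupport_subset _ _ ((mem_topBlock _ _).1 ht).1
      obtain ⟨r, hr, rfl⟩ := mem_image.1 htT
      have hr' : r < 2 ^ (ℓ - 1) := mem_range.1 (mem_erase.1 hr).2
      have n01 : (0 : Fin 3) ≠ 1 := by decide
      have n02 : (0 : Fin 3) ≠ 2 := by decide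
      have n12 : (1 : Fin 3) ≠ 2 := by decide
      have n21 : (2 : Fin 3) ≠ 1 := by decide
      fin_cases i
      · simp [Finsupp.single_eq_of_ne n01, Finsupp.single_eq_of_ne n02]
      · simp only [Finsupp.smul_apply, Finsupp.add_apply, smul_eq_mul, Finsupp.single_eq_same,
          Finsupp.single_eq_of_ne n12, mul_one, add_zero, Fin.mk_one]
        omega
      · simp only [Finsupp.smul_apply, Finsupp.add_apply, smul_eq_mul, Finsupp.single_eq_same,
          Finsupp.single_eq_of_ne n21, mul_zero, zero_add, mul_one, Fin.reduceFinMk]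
        omega

/-- The same with the difference in p502315's `admBelow 2 1 ℓ E_SB` (the class used by `FiniteRayReduction (admBelow …)`:
`M_<` of EVERY depth-`ℓ` standard expression of `E_SB`). [cite: Hironaka2017, Lem. 9.5 p.50 l.11–14 (kernel certificate about OUR model; not a verdict)] -/
theorem existsAdmissibleFiniteRay_box_admBelow {ℓ : ℕ} (hℓ : 2 ≤ ℓ) :
    ∃ ε' : MvPowerSeries (Fin 3) 𝔽, toFin 𝔽 2 εB - ε' ∈ admBelow 2 1 ℓ (toFin 𝔽 2 εB) ∧
      ∃ X : StandardExpression 2 MvPowerSeries.X 1 ℓ ε',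
        (alpha X.support X.u = Finsupp.single 2 1 ∧ beta X.support X.u = 0) ∧
          (topFrontierExp 2 X.support X.u).degree < 2 ^ ℓ ∧
            ∀ t ∈ topBlock X.support X.u, ∀ i : Fin 3, (2 • t.2.2) i < 2 ^ ℓ := by
  obtain ⟨ε', hB, X, hX⟩ := existsAdmissibleFiniteRay_box_span hℓ
  exact ⟨ε', mem_admBelow_of_memBelowSpan hℓ hB, X, hX⟩

/-- **`ℓ = 3` (box, span model)**: YES — a depth-`3` expression with every top-block coordinate `< 8` (`2c ∈ {(0,2,2),
(0,4,2), (0,6,2)}`). [cite: Hironaka2017, Lem. 9.5 p.50 l.11–14 (kernel certificate about OUR model)] -/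
theorem T1_box_span_depth_three :
    ∃ ε' : MvPowerSeries (Fin 3) 𝔽,
      MemBelowSpan 2 1 3 (Finsupp.single (2 : Fin 3) 1) 0
          (ray 2 1 (Finsupp.single (2 : Fin 3) 1) 0 (toFin 𝔽 2 εB)) (toFin 𝔽 2 εB - ε') ∧
        ∃ X : StandardExpression 2 MvPowerSeries.X 1 3 ε',
          (alpha X.support X.u = Finsupp.single 2 1 ∧ beta X.support X.u = 0) ∧
            (topFrontierExp 2 X.support X.u).degree < 2 ^ 3 ∧
              ∀ t ∈ topBlock X.support X.u, ∀ i : Fin 3, (2 • t.2.2) i < 2 ^ 3 :=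
  existsAdmissibleFiniteRay_box_span (by norm_num)

/-- **`ℓ = 4` (box, span model)**: YES — every top-block coordinate `< 16` (`(2c)₁ ≤ 14`). [cite: Hironaka2017, Lem. 9.5 p.50 l.11–14 (kernel certificate about OUR model)] -/
theorem T2_box_span_depth_four :
    ∃ ε' : MvPowerSeries (Fin 3) 𝔽,
      MemBelowSpan 2 1 4 (Finsupp.single (2 : Fin 3) 1) 0
          (ray 2 1 (Finsupp.single (2 : Fin 3) 1) 0 (toFin 𝔽 2 εB)) (toFin 𝔽 2 εB - ε') ∧
        ∃ X : StandardExpression 2 MvPowerSeries.X 1 4 ε',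
          (alpha X.support X.u = Finsupp.single 2 1 ∧ beta X.support X.u = 0) ∧
            (topFrontierExp 2 X.support X.u).degree < 2 ^ 4 ∧
              ∀ t ∈ topBlock X.support X.u, ∀ i : Fin 3, (2 • t.2.2) i < 2 ^ 4 :=
  existsAdmissibleFiniteRay_box_span (by norm_num)

end Summit.ResolutionOfSingularities.ResolutionOfSingularities.Theorems.CampaignW25.SBSpan

end
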